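import Literature.NumberTheory.LFunctions.ConreyIwaniec2002KernelMellin
import Literature.NumberTheory.LFunctions.ConreyIwaniec2002GenusZFactorBounds
import Literature.Analysis.Complex.MellinInvContinuation
import Literature.NumberTheory.LFunctions.ZetaFractionalPartIntegral
import Literature.NumberTheory.LFunctions.ZetaOneLineBounds
import Literature.NumberTheory.LFunctions.ZetaArgBacklundExplicit
import Mathlib.NumberTheory.Harmonic.ZetaAsymp
import Mathlib.Analysis.Complex.RemovableSingularity
import Mathlib.Analysis.PSeries
import HarnessLib

/-!
# Conrey–Iwaniec (2002), §6 (6.29)–(6.34): the off-diagonal series `D(v)` as a Mellin–Barnes integral on `Re s = σ₀ < 1`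

B. Conrey, H. Iwaniec, Acta Arith. 103 (2002), §6 [held text `paper:arxiv-math_0111012`,
p0015:L128–p0016:L36]: "`D(v) = Σ_{h≥1} σ(h)L(hv)` (6.29) … Let `M(s)` be the Mellin transform of
`L(v)` … the product `M(s)Z(s)` is holomorphic in the strip `0 < σ ≤ 3/2` (no pole at `s = 1`) …
`D(v) = (1/2πi)∫_{(σ)} M(s)Z(s)v^{-s}ds`".

PROVED HERE (step C1 of the registered stub S5 `stub_offdiagonal` of SKELETON P64, cell
landau-siegel/ls-inputs, line `thm61-cm-convolution`), for an admissible kernel `K`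
(`IsCIKernel K`, `L = ciL K`, `M = 𝓜L`), coefficients `σ` with `|σ(h)| ≤ 2ℓ²σ₋₁(h)` and the genus
generating series (4.34) `Z(s) = Σσ(h)h^{-s} = κℓ²(ε₁F_{v,w}(s) + ε₂F_{w,v}(s))ζ(s)ζ(s+1)` on
`Re s > 1` (the second branch of the tree's `IsCISigma`):
* `D(u) = (1/2π)∫ u^{-(3/2+it)} Z(3/2+it) M(3/2+it) dt` (termwise Mellin inversion of `L`, tree
  `KernelMellin.ciL_eq_mellinInv`, and `Σ∫ = ∫Σ`);
* the holomorphic continuation `Φ(s) = κℓ²(ε₁F_{v,w}+ε₂F_{w,v})(s)·(dslope M 1)(s)·ζ₁(s)·ζ(s+1)`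
  of `Z·M` to `0 < Re s < 4` (`M(1) = 0` cancels the pole of `ζ`; `ζ₁` is Mathlib's entire
  `(s−1)ζ(s)`), its bounds on vertical lines, and the LINE MOVE
  `D(u) = (1/2π)∫ u^{-(c+it)} Φ(c+it) dt` for every `0 < c ≤ 1/2`
  (tree `mellinInv_eq_mellinInv_of_differentiableOn`).

## References
* [ConreyIwaniec2002] B. Conrey, H. Iwaniec, Acta Arith. 103 (2002) 259–312: §4 (4.34); §6 (6.29), (6.32)–(6.34).
* [Titchmarsh1986] E. C. Titchmarsh, *The Theory of the Riemann Zeta-Function*, §2.1, §2.12, §3.5, §4.12.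
-/

noncomputable section

open Complex MeasureTheory Set Filter Real
open scoped Topology

namespace Literature.NumberTheory.LFunctions

namespace ConreyIwaniec2002

namespace OffDiagMellin

open KernelMellin GenusZFactorBounds

/-! ### The coefficients `σ(h)`: size and summability -/

section Sigma

variable {σ : ℕ → ℝ} {ℓ : ℝ}
  (hσb : ∀ h : ℕ, 1 ≤ h → |σ h| ≤ 2 * ℓ ^ 2 * ∑ d ∈ Nat.divisors h, (d : ℝ)⁻¹)
include hσb

/-- `|σ(h)| ≤ 2ℓ²(1 + log h)`. [cite: ConreyIwaniec2002, §6 (6.20)] -/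
theorem abs_sigma_le {h : ℕ} (hh : 1 ≤ h) : |σ h| ≤ 2 * ℓ ^ 2 * (1 + Real.log h) :=
  (hσb h hh).trans (mul_le_mul_of_nonneg_left (sum_divisors_inv_le (by omega)) (by positivity))

/-- `|σ(h)| h^{-3/2} ≤ 10ℓ² h^{-5/4}` (from `log h ≤ 4h^{1/4}`). [cite: ConreyIwaniec2002, §6 (6.20)] -/
theorem abs_sigma_mul_rpow_le {h : ℕ} (hh : 1 ≤ h) :
    |σ h| * (h : ℝ) ^ (-(3 / 2 : ℝ)) ≤ 10 * ℓ ^ 2 * (h : ℝ) ^ (-(5 / 4 : ℝ)) := by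
  have hh0 : (0 : ℝ) < h := by exact_mod_cast hh
  have hh1 : (1 : ℝ) ≤ h := by exact_mod_cast hh
  have hlog : Real.log h ≤ 4 * (h : ℝ) ^ (1 / 4 : ℝ) := by
    have := Real.log_le_rpow_div hh0.le (by norm_num : (0:ℝ) < 1 / 4)
    linarith [this]
  have hq : (h : ℝ) ^ (1 / 4 : ℝ) ≥ 1 := Real.one_le_rpow hh1 (by norm_num)
  have h1 : 1 + Real.log h ≤ 5 * (h : ℝ) ^ (1 / 4 : ℝ) := by linarith
  have e : (h : ℝ) ^ (1 / 4 : ℝ) * (h : ℝ) ^ (-(3 / 2 : ℝ)) = (h : ℝ) ^ (-(5 / 4 : ℝ)) := by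
    rw [← Real.rpow_add hh0]; norm_num
  calc |σ h| * (h : ℝ) ^ (-(3 / 2 : ℝ)) ≤ 2 * ℓ ^ 2 * (1 + Real.log h) * (h : ℝ) ^ (-(3 / 2 : ℝ)) :=
        mul_le_mul_of_nonneg_right (abs_sigma_le hσb hh) (Real.rpow_nonneg hh0.le _)
    _ ≤ 2 * ℓ ^ 2 * (5 * (h : ℝ) ^ (1 / 4 : ℝ)) * (h : ℝ) ^ (-(3 / 2 : ℝ)) := by gcongr
    _ = 10 * ℓ ^ 2 * ((h : ℝ) ^ (1 / 4 : ℝ) * (h : ℝ) ^ (-(3 / 2 : ℝ))) := by ring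
    _ = 10 * ℓ ^ 2 * (h : ℝ) ^ (-(5 / 4 : ℝ)) := by rw [e]

/-- The Dirichlet series `Z(s) = Σσ(h)h^{-s}` converges absolutely on `Re s = 3/2`.
[cite: ConreyIwaniec2002, §6 (6.21)] -/
theorem lseriesSummable_sigma (t : ℝ) :
    LSeriesSummable (fun n : ℕ => (σ n : ℂ)) ((3 / 2 : ℝ) + t * I) := by
  rw [LSeriesSummable, ← summable_norm_iff]
  have hmaj : Summable fun n : ℕ => 10 * ℓ ^ 2 * (n : ℝ) ^ (-(5 / 4 : ℝ)) :=
    ((Real.summable_nat_rpow.mpr (by norm_num)).mul_left _)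
  refine Summable.of_nonneg_of_le (fun n => norm_nonneg _) (fun n => ?_) hmaj
  rw [LSeries.norm_term_eq]
  rcases Nat.eq_zero_or_pos n with hn | hn
  · simp [hn]
  · rw [if_neg hn.ne']
    have hre : (((3 / 2 : ℝ) : ℂ) + t * I).re = 3 / 2 := by simp
    rw [hre, Complex.norm_real, Real.norm_eq_abs, div_eq_mul_inv, ← Real.rpow_neg (by positivity)]
    exact abs_sigma_mul_rpow_le hσb hn

end Sigma

/-! ### `D(u)` as a Mellin–Barnes integral on `Re s = 3/2` -/

section DMellin

variable {K : ℝ → ℝ} (hK : IsCIKernel K) {σ : ℕ → ℝ} {ℓ : ℝ}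
  (hσb : ∀ h : ℕ, 1 ≤ h → |σ h| ≤ 2 * ℓ ^ 2 * ∑ d ∈ Nat.divisors h, (d : ℝ)⁻¹)
include hK hσb

/-- **`D(u) = (1/2πi)∫_{(3/2)} Z(s)M(s)u^{-s}ds`** for `u > 0`: termwise Mellin inversion
`L(nu) = (1/2π)∫(nu)^{-(c+it)}M(c+it)dt` and `Σ∫ = ∫Σ` (justified by
`Σ|σ(n)|n^{-3/2}·u^{-3/2}∫|M| < ∞`). [cite: ConreyIwaniec2002, §6 (6.29), (6.34)] -/
theorem ciD_eq_mellinInv {u : ℝ} (hu : 0 < u) :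
    ((ciD K σ u : ℝ) : ℂ) =
      mellinInv (3 / 2) (fun s => LSeries (fun n : ℕ => (σ n : ℂ)) s *
        mellin (fun v : ℝ => ((ciL K v : ℝ) : ℂ)) s) u := by
  set c : ℝ := 3 / 2 with hc
  set M : ℂ → ℂ := mellin (fun v : ℝ => ((ciL K v : ℝ) : ℂ)) with hM
  have hc0 : 0 < c := by norm_num
  have hMint : Integrable fun y : ℝ => M (c + y * I) :=
    verticalIntegrable_mellin_ciL hK hc0 (by norm_num)
  -- the `n`-th integrand
  set G : ℕ → ℝ → ℂ := fun n y => (u : ℂ) ^ (-((c : ℂ) + y * I)) •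
    (LSeries.term (fun n : ℕ => (σ n : ℂ)) (c + y * I) n * M (c + y * I)) with hG
  have hnormG : ∀ n y, ‖G n y‖ = u ^ (-c) * (‖LSeries.term (fun n : ℕ => (σ n : ℂ)) c n‖ *
      ‖M (c + y * I)‖) := by
    intro n y
    simp only [hG, norm_smul, norm_mul]
    rw [Complex.norm_cpow_eq_rpow_re_of_pos hu]
    simp [LSeries.norm_term_eq]
  -- each term: `σ(n) L(nu) = (1/2π) ∫ G n`
  have hterm : ∀ n : ℕ, (if n = 0 then (0:ℂ) else (σ n : ℂ) * ((ciL K (n * u) : ℝ) : ℂ)) =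
      (1 / (2 * Real.pi) : ℂ) * ∫ y : ℝ, G n y := by
    intro n
    rcases eq_or_ne n 0 with rfl | hn
    · simp [hG]
    simp only [hn, if_false]
    have hn0 : (0 : ℝ) < n := by exact_mod_cast Nat.pos_of_ne_zero hn
    have hinv := ciL_eq_mellinInv hK hc0 (by norm_num) (mul_pos hn0 hu)
    rw [hinv, mellinInv, Complex.real_smul]
    simp only [hG, smul_eq_mul]
    rw [← mul_assoc, mul_comm ((σ n : ℝ) : ℂ), mul_assoc, ← integral_const_mul]
    congr 1
    · push_cast; ring
    refine integral_congr_ae (Eventually.of_forall fun y => ?_)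
    simp only
    rw [Complex.ofReal_mul, Complex.mul_cpow_ofReal_nonneg hn0.le hu.le, LSeries.term_of_ne_zero hn,
      div_eq_mul_inv, ← Complex.cpow_neg, Complex.ofReal_natCast]
    ring
  -- integrability and summability of the norms
  have hcontu : Continuous fun y : ℝ => (u : ℂ) ^ (-((c : ℂ) + y * I)) :=
    Continuous.const_cpow (by fun_prop) (Or.inl (by exact_mod_cast hu.ne'))
  have hcontn : ∀ n : ℕ, Continuous fun y : ℝ => LSeries.term (fun n : ℕ => (σ n : ℂ)) (c + y * I) n := by
    intro n
    rcases eq_or_ne n 0 with rfl | hn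
    · simp only [LSeries.term_zero]; exact continuous_const
    · simp only [LSeries.term_of_ne_zero hn, div_eq_mul_inv]
      refine continuous_const.mul (Continuous.inv₀ ?_ fun y => ?_)
      · exact Continuous.const_cpow (by fun_prop) (Or.inl (by exact_mod_cast hn))
      · exact (Complex.cpow_ne_zero_iff_of_exponent_ne_zero (by
          intro h0; have := congrArg Complex.re h0; simp [hc] at this)).2
          (by exact_mod_cast hn)
  have hint : ∀ n, Integrable (G n) := by
    intro n
    have h := hMint.bdd_mul ((hcontu.mul (hcontn n)).aestronglyMeasurable)
      (c := u ^ (-c) * ‖LSeries.term (fun n : ℕ => (σ n : ℂ)) c n‖)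
      (Eventually.of_forall fun y => ?_)
    · refine h.congr (Eventually.of_forall fun y => ?_)
      simp only [hG, Pi.mul_apply, smul_eq_mul]; ring
    · rw [Pi.mul_apply, norm_mul, Complex.norm_cpow_eq_rpow_re_of_pos hu]
      simp [LSeries.norm_term_eq]
  have hnormint : ∀ n, ∫ y, ‖G n y‖ = u ^ (-c) * (‖LSeries.term (fun n : ℕ => (σ n : ℂ)) c n‖ *
      ∫ y : ℝ, ‖M (c + y * I)‖) := by
    intro n
    simp_rw [hnormG]
    rw [integral_const_mul, integral_const_mul]
  have hsumm : Summable fun n => ∫ y, ‖G n y‖ := by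
    simp_rw [hnormint]
    have hs := lseriesSummable_sigma hσb 0
    simp only [Complex.ofReal_zero, zero_mul, add_zero] at hs
    have hs' : Summable fun n => ‖LSeries.term (fun n : ℕ => (σ n : ℂ)) c n‖ := by
      rw [hc]; exact summable_norm_iff.mpr (by exact_mod_cast hs)
    exact ((hs'.mul_right _).mul_left _)
  -- the left side as a `tsum` over `n ≥ 1`
  have hsumG : Summable fun n : ℕ => (if n = 0 then (0:ℂ) else (σ n : ℂ) * ((ciL K (n * u) : ℝ) : ℂ)) := by
    simp_rw [hterm]
    refine Summable.mul_left _ ?_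
    exact (hsumm.of_norm_bounded (fun n => norm_integral_le_integral_norm _))
  have hlhs : ((ciD K σ u : ℝ) : ℂ) =
      ∑' n : ℕ, (if n = 0 then (0:ℂ) else (σ n : ℂ) * ((ciL K (n * u) : ℝ) : ℂ)) := by
    rw [ciD, Complex.ofReal_tsum, hsumG.tsum_eq_zero_add]
    simp only [if_true, zero_add, Nat.succ_ne_zero, if_false]
    refine tsum_congr fun h => ?_
    push_cast
    ring_nf
  -- interchange
  rw [hlhs, mellinInv]
  calc ∑' n : ℕ, (if n = 0 then (0:ℂ) else (σ n : ℂ) * ((ciL K (n * u) : ℝ) : ℂ))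
      = ∑' n : ℕ, (1 / (2 * Real.pi) : ℂ) * ∫ y : ℝ, G n y := tsum_congr hterm
    _ = (1 / (2 * Real.pi) : ℂ) * ∑' n : ℕ, ∫ y : ℝ, G n y := tsum_mul_left
    _ = (1 / (2 * Real.pi) : ℂ) * ∫ y : ℝ, ∑' n : ℕ, G n y := by
        rw [integral_tsum_of_summable_integral_norm hint hsumm]
    _ = (1 / (2 * Real.pi) : ℝ) • ∫ y : ℝ, (u : ℂ) ^ (-((c : ℂ) + y * I)) •
          (LSeries (fun n : ℕ => (σ n : ℂ)) (c + y * I) * M (c + y * I)) := by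
        rw [Complex.real_smul]
        push_cast
        congr 1
        refine integral_congr_ae (Eventually.of_forall fun y => ?_)
        simp only [hG, smul_eq_mul, LSeries]
        rw [← tsum_mul_right, ← tsum_mul_left]

end DMellin

/-! ### `ζ` on small rectangles and on vertical lines (Titchmarsh §§2.12, 3.5, 4.12) -/

section Zeta

/-- `ζ₁ = (s−1)ζ(s)` is bounded on the compact rectangle `a ≤ Re s ≤ b`, `|Im s| ≤ 3`.
[cite: Titchmarsh1986, §2.1 (2.1.4)] -/
theorem exists_bound_zeta₁_rect (a b : ℝ) :
    ∃ C : ℝ, 0 < C ∧ ∀ s : ℂ, a ≤ s.re → s.re ≤ b → |s.im| ≤ 3 → ‖riemannZeta₁ s‖ ≤ C := by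
  set R : Set ℂ := {s : ℂ | a ≤ s.re ∧ s.re ≤ b ∧ |s.im| ≤ 3} with hR
  have hclosed : IsClosed R := by
    have h1 : IsClosed {s : ℂ | a ≤ s.re} := isClosed_le continuous_const Complex.continuous_re
    have h2 : IsClosed {s : ℂ | s.re ≤ b} := isClosed_le Complex.continuous_re continuous_const
    have h3 : IsClosed {s : ℂ | |s.im| ≤ 3} :=
      isClosed_le (continuous_abs.comp Complex.continuous_im) continuous_const
    have : R = {s : ℂ | a ≤ s.re} ∩ ({s : ℂ | s.re ≤ b} ∩ {s : ℂ | |s.im| ≤ 3}) := by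
      ext s; simp [hR]
    rw [this]; exact h1.inter (h2.inter h3)
  have hbdd : Bornology.IsBounded R := by
    refine (Metric.isBounded_closedBall (x := (0:ℂ)) (r := |a| + |b| + 3)).subset fun s hs => ?_
    rw [Metric.mem_closedBall, dist_zero_right]
    have hre : |s.re| ≤ |a| + |b| := by
      rcases hs with ⟨h1, h2, _⟩
      rw [abs_le]; constructor
      · linarith [neg_abs_le a, abs_nonneg b]
      · linarith [le_abs_self b, abs_nonneg a]
    calc ‖s‖ ≤ |s.re| + |s.im| := Complex.norm_le_abs_re_add_abs_im s
      _ ≤ |a| + |b| + 3 := by linarith [hs.2.2]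
  have hcomp : IsCompact R := Metric.isCompact_of_isClosed_isBounded hclosed hbdd
  obtain ⟨C, hC⟩ := hcomp.exists_bound_of_continuousOn
    (differentiable_riemannZeta₁.continuous.continuousOn)
  refine ⟨max C 1, by positivity, fun s h1 h2 h3 => (hC s ⟨h1, h2, h3⟩).trans (le_max_left _ _)⟩

/-- `‖ζ(3/2 + it)‖ ≤ ζ(3/2)` and `‖ζ(5/2+it)‖ ≤ ζ(5/2)` (as the real values).
[cite: Titchmarsh1986, §2.12] -/
theorem norm_zeta_line_le {c : ℝ} (hc : 1 < c) (t : ℝ) :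
    ‖riemannZeta (c + t * I)‖ ≤ (riemannZeta c).re := by
  have h := norm_riemannZeta_le_re_riemannZeta (s := c + t * I) (by simp; exact hc)
  simpa using h

/-- Crude bound in the strip: `‖ζ(σ+it)‖ ≤ (|t|+2)(1 + 1/σ)` for `σ > 0`, `|t| ≥ 3`.
[cite: Titchmarsh1986, §2.12 (2.12.2)] -/
theorem norm_zeta_le_crude {σ t : ℝ} (hσ : 0 < σ) (hσ2 : σ ≤ 2) (ht : 3 ≤ |t|) :
    ‖riemannZeta (σ + t * I)‖ ≤ (|t| + 2) * (1 + σ⁻¹) := by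
  have hs1 : (σ : ℂ) + t * I ≠ 1 := by
    intro h; have := congrArg Complex.im h; simp at this; rw [this] at ht; norm_num at ht
  have h := norm_riemannZeta_le_of_re_pos (s := σ + t * I) (by simp; exact hσ) hs1
  have hns : ‖(σ : ℂ) + t * I‖ ≤ |t| + 2 := by
    calc ‖(σ : ℂ) + t * I‖ ≤ |((σ : ℂ) + t * I).re| + |((σ : ℂ) + t * I).im| :=
          Complex.norm_le_abs_re_add_abs_im _
      _ = |σ| + |t| := by simp
      _ ≤ |t| + 2 := by rw [abs_of_pos hσ]; linarith
  have hns1 : (1 : ℝ) ≤ ‖(σ : ℂ) + t * I - 1‖ := by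
    calc (1:ℝ) ≤ 3 := by norm_num
      _ ≤ |t| := ht
      _ = |((σ : ℂ) + t * I - 1).im| := by simp
      _ ≤ ‖(σ : ℂ) + t * I - 1‖ := Complex.abs_im_le_norm _
  have hre : ((σ : ℂ) + t * I).re = σ := by simp
  rw [hre] at h
  calc ‖riemannZeta (σ + t * I)‖ ≤ ‖(σ : ℂ) + t * I‖ / ‖(σ : ℂ) + t * I - 1‖ + ‖(σ : ℂ) + t * I‖ / σ := h
    _ ≤ (|t| + 2) / 1 + (|t| + 2) / σ := by
        gcongr
    _ = (|t| + 2) * (1 + σ⁻¹) := by ring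

/-- **`ζ` left of the critical line, `|t| ≥ 3`, `0 < c ≤ 1/2`**: (i) always
`‖ζ(c+it)‖ ≤ 10|t|^{3/2}`; (ii) if `c ≤ 1/(2 log|t|)` then `‖ζ(c+it)‖ ≤ 42|t|^{1/2} log|t|`
(functional equation (4.12.3) + Titchmarsh 3.5 on the reflected line).
[cite: Titchmarsh1986, §4.12 (4.12.3), Thm 3.5] -/
theorem norm_zeta_left_le {c t : ℝ} (hc : 0 < c) (hc2 : c ≤ 1 / 2) (ht : 3 ≤ |t|) :
    ‖riemannZeta (c + t * I)‖ ≤ 10 * |t| ^ (3 / 2 : ℝ) ∧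
      (c ≤ 1 / (2 * Real.log |t|) → ‖riemannZeta (c + t * I)‖ ≤ 42 * |t| ^ (1 / 2 : ℝ) * Real.log |t|) := by
  have ht0 : 0 < |t| := by linarith
  have hfe := ZetaArgBacklund.norm_riemannZeta_le_fe (σ := c) (t := t) (by linarith) hc2 (by linarith)
  -- the prefactor `e^{1/2}(|t|/2π)^{1/2-c} ≤ 2|t|^{1/2}`
  have hpre : Real.exp (1 / 2) * (|t| / (2 * Real.pi)) ^ (1 / 2 - c) ≤ 2 * |t| ^ (1 / 2 : ℝ) := by
    have he : Real.exp (1 / 2) ≤ 2 := by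
      have := Real.exp_one_lt_three
      have h2 : Real.exp (1 / 2) * Real.exp (1 / 2) = Real.exp 1 := by
        rw [← Real.exp_add]; norm_num
      nlinarith [Real.exp_pos (1/2 : ℝ)]
    have hbase : |t| / (2 * Real.pi) ≤ |t| := by
      rw [div_le_iff₀ (by positivity)]; nlinarith [Real.pi_gt_three]
    have hpow : (|t| / (2 * Real.pi)) ^ (1 / 2 - c) ≤ |t| ^ (1 / 2 : ℝ) := by
      rcases le_or_gt 1 (|t| / (2 * Real.pi)) with h1 | h1
      · calc (|t| / (2 * Real.pi)) ^ (1 / 2 - c) ≤ (|t| / (2 * Real.pi)) ^ (1 / 2 : ℝ) :=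
            Real.rpow_le_rpow_of_exponent_le h1 (by linarith)
          _ ≤ |t| ^ (1 / 2 : ℝ) := Real.rpow_le_rpow (by positivity) hbase (by norm_num)
      · calc (|t| / (2 * Real.pi)) ^ (1 / 2 - c) ≤ 1 :=
            Real.rpow_le_one (by positivity) h1.le (by linarith)
          _ ≤ |t| ^ (1 / 2 : ℝ) := Real.one_le_rpow (by linarith) (by norm_num)
    exact mul_le_mul he hpow (by positivity) (by norm_num)
  -- the reflected point
  have hrefl : ((1 : ℂ) - c + t * I) = (((1 - c : ℝ)) : ℂ) + t * I := by push_cast; ring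
  refine ⟨?_, ?_⟩
  · have h1 : ‖riemannZeta (1 - c + t * I)‖ ≤ 5 * |t| := by
      rw [hrefl]
      have h := norm_zeta_le_crude (σ := 1 - c) (t := t) (by linarith) (by linarith) ht
      refine h.trans ?_
      have h1c : 0 < 1 - c := by linarith
      have h2 : (1 - c)⁻¹ ≤ 2 := by rw [inv_le_comm₀ h1c (by norm_num)]; linarith
      have h3 : 0 ≤ (1 - c)⁻¹ := inv_nonneg.mpr h1c.le
      nlinarith
    calc ‖riemannZeta (c + t * I)‖ ≤ Real.exp (1 / 2) * (|t| / (2 * Real.pi)) ^ (1 / 2 - c) *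
          ‖riemannZeta (1 - c + t * I)‖ := hfe
      _ ≤ 2 * |t| ^ (1 / 2 : ℝ) * (5 * |t|) := mul_le_mul hpre h1 (norm_nonneg _) (by positivity)
      _ = 10 * (|t| ^ (1 / 2 : ℝ) * |t| ^ (1 : ℝ)) := by rw [Real.rpow_one]; ring
      _ = 10 * |t| ^ (3 / 2 : ℝ) := by rw [← Real.rpow_add ht0]; norm_num
  · intro hcl
    have h1 : ‖riemannZeta (1 - c + t * I)‖ ≤ 21 * Real.log |t| := by
      rw [hrefl]
      have hcl' : c ≤ (Real.log t)⁻¹ * 2⁻¹ := by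
        rw [← Real.log_abs]; rw [one_div, mul_inv, mul_comm] at hcl; exact hcl
      have hside : 1 - 1 / (2 * Real.log |(((1 - c : ℝ) : ℂ) + t * I).im|) ≤ (((1 - c : ℝ) : ℂ) + t * I).re := by
        have him : (((1 - c : ℝ) : ℂ) + t * I).im = t := by simp
        have hre : (((1 - c : ℝ) : ℂ) + t * I).re = 1 - c := by simp
        rw [him, hre, Real.log_abs]
        have : 1 / (2 * Real.log t) = (Real.log t)⁻¹ * 2⁻¹ := by rw [one_div, mul_inv, mul_comm]
        rw [this]; linarith
      have h := ZetaOneLine.norm_riemannZeta_le_log (s := ((1 - c : ℝ) : ℂ) + t * I) (by simp; exact ht) hside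
      simpa using h
    calc ‖riemannZeta (c + t * I)‖ ≤ Real.exp (1 / 2) * (|t| / (2 * Real.pi)) ^ (1 / 2 - c) *
          ‖riemannZeta (1 - c + t * I)‖ := hfe
      _ ≤ 2 * |t| ^ (1 / 2 : ℝ) * (21 * Real.log |t|) :=
          mul_le_mul hpre h1 (norm_nonneg _) (by positivity)
      _ = 42 * |t| ^ (1 / 2 : ℝ) * Real.log |t| := by ring

/-- `‖ζ(1 + c + it)‖ ≤ 21 log|t|` for `c ≥ 0`, `|t| ≥ 3`. [cite: Titchmarsh1986, Thm 3.5] -/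
theorem norm_zeta_right_le {c t : ℝ} (hc : 0 ≤ c) (ht : 3 ≤ |t|) :
    ‖riemannZeta (c + t * I + 1)‖ ≤ 21 * Real.log |t| := by
  have := ZetaOneLine.norm_riemannZeta_le_log (s := (c : ℂ) + t * I + 1) (by simp; exact ht)
    (by
      simp only [Complex.add_re, Complex.ofReal_re, Complex.mul_re, Complex.I_re, Complex.I_im,
        Complex.ofReal_im, Complex.one_re, Complex.add_im, Complex.mul_im, Complex.one_im]
      have hlog : 0 < Real.log |t| := Real.log_pos (by linarith)
      have h2 : 0 ≤ (Real.log t)⁻¹ * (1 / 2) := by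
        rcases le_or_gt 0 t with h | h
        · rw [abs_of_nonneg h] at hlog; positivity
        · have : Real.log t = Real.log |t| := by rw [← Real.log_abs]
          rw [this]; positivity
      norm_num
      linarith)
  simpa using this

end Zeta

/-! ### The holomorphic continuation `Φ` of `Z(s)M(s)` -/

/-- **`Φ(s) = κℓ²(ε₁F_{v,w}(s) + ε₂F_{w,v}(s)) · (dslope M 1)(s)·ζ₁(s) · ζ(s+1)`**, the holomorphic
continuation to `0 < Re s < 4` of `Z(s)M(s)` ((6.33): "the product `M(s)Z(s)` is holomorphic in the
strip `0 < σ ≤ 3/2` (no pole at `s = 1`)" — here `M(1) = 0` is absorbed by `dslope`, the pole of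
`ζ` by Mathlib's entire `ζ₁ = (s−1)ζ`). [cite: ConreyIwaniec2002, §6 (6.33)] -/
def genusPhi (K : ℝ → ℝ) (κ ℓ ε₁ ε₂ : ℝ) (v w : ℕ) (s : ℂ) : ℂ :=
  (((κ * ℓ ^ 2 : ℝ) : ℂ) * ((ε₁ : ℂ) * genusZFactor v w s + (ε₂ : ℂ) * genusZFactor w v s)) *
    ((dslope (mellin fun x : ℝ => ((ciL K x : ℝ) : ℂ)) 1 s * riemannZeta₁ s) * riemannZeta (s + 1))

section Phi

variable {K : ℝ → ℝ} (hK : IsCIKernel K)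
include hK

/-- Off `s = 1`, `(dslope M 1)(s)·ζ₁(s) = M(s)ζ(s)` (as `M(1) = 0`).
[cite: ConreyIwaniec2002, §6 (6.33)] -/
theorem dslope_mul_zeta₁_eq {s : ℂ} (hs : s ≠ 1) :
    dslope (mellin fun x : ℝ => ((ciL K x : ℝ) : ℂ)) 1 s * riemannZeta₁ s =
      mellin (fun x : ℝ => ((ciL K x : ℝ) : ℂ)) s * riemannZeta s := by
  rw [dslope_of_ne _ hs, slope_def_module, mellin_ciL_one hK, sub_zero, riemannZeta_eq_inv_sub_mul hs,
    smul_eq_mul]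
  have : (s - 1) ≠ 0 := sub_ne_zero.mpr hs
  field_simp

omit hK in
/-- The genus factors are entire. [cite: ConreyIwaniec2002, §4 (4.34)] -/
theorem differentiable_genusZFactor (v w : ℕ) : Differentiable ℂ (genusZFactor v w) := by
  intro s
  have h1 : DifferentiableAt ℂ (fun z : ℂ => ∏ p ∈ v.primeFactors, ((p : ℂ)⁻¹ - (p : ℂ) ^ (-z))) s := by
    refine DifferentiableAt.fun_finsetProd (f := fun (p : ℕ) (z : ℂ) => ((p : ℂ)⁻¹ - (p : ℂ) ^ (-z)))
      fun p hp => ?_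
    have hp0 : (p : ℂ) ≠ 0 := by exact_mod_cast (Nat.prime_of_mem_primeFactors hp).ne_zero
    exact (differentiableAt_const _).sub
      (DifferentiableAt.const_cpow (f := fun z : ℂ => -z) differentiableAt_id.neg (Or.inl hp0))
  have h2 : DifferentiableAt ℂ (fun z : ℂ => ∏ p ∈ w.primeFactors, (1 - (p : ℂ) ^ (-z - 1))) s := by
    refine DifferentiableAt.fun_finsetProd (f := fun (p : ℕ) (z : ℂ) => (1 - (p : ℂ) ^ (-z - 1)))
      fun p hp => ?_
    have hp0 : (p : ℂ) ≠ 0 := by exact_mod_cast (Nat.prime_of_mem_primeFactors hp).ne_zero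
    exact (differentiableAt_const _).sub
      (DifferentiableAt.const_cpow (f := fun z : ℂ => -z - 1) (differentiableAt_id.neg.sub_const 1)
        (Or.inl hp0))
  exact h1.mul h2

/-- `Φ` is holomorphic on `0 < Re s < 4`. [cite: ConreyIwaniec2002, §6 (6.33)] -/
theorem differentiableOn_genusPhi (κ ℓ ε₁ ε₂ : ℝ) (v w : ℕ) :
    DifferentiableOn ℂ (genusPhi K κ ℓ ε₁ ε₂ v w) {s : ℂ | 0 < s.re ∧ s.re < 4} := by
  set U : Set ℂ := {s : ℂ | 0 < s.re ∧ s.re < 4} with hU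
  have hUo : IsOpen U :=
    (isOpen_lt continuous_const Complex.continuous_re).inter (isOpen_lt Complex.continuous_re continuous_const)
  have h1U : U ∈ 𝓝 (1 : ℂ) := hUo.mem_nhds (by simp [hU])
  have hM : DifferentiableOn ℂ (mellin fun x : ℝ => ((ciL K x : ℝ) : ℂ)) U := fun s hs =>
    (differentiableAt_mellin_ciL hK hs.1 hs.2).differentiableWithinAt
  have hds : DifferentiableOn ℂ (dslope (mellin fun x : ℝ => ((ciL K x : ℝ) : ℂ)) 1) U :=
    (Complex.differentiableOn_dslope h1U).mpr hM
  intro s hs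
  have hz1 : DifferentiableAt ℂ (fun z => riemannZeta (z + 1)) s := by
    have hne : s + 1 ≠ 1 := by
      intro h; have := congrArg Complex.re h; simp at this; linarith [hs.1]
    exact (differentiableAt_riemannZeta hne).comp s (differentiableAt_id.add_const 1)
  unfold genusPhi
  refine DifferentiableWithinAt.mul ?_ (DifferentiableWithinAt.mul ?_ hz1.differentiableWithinAt)
  · exact ((differentiableAt_const _).mul
      (((differentiableAt_const _).mul (differentiable_genusZFactor v w s)).add
        ((differentiableAt_const _).mul (differentiable_genusZFactor w v s)))).differentiableWithinAt
  · exact (hds s hs).mul (differentiable_riemannZeta₁ s).differentiableWithinAt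

/-- On `Re s > 1`, `Φ = Z·M` whenever `Z` has the genus form (4.34).
[cite: ConreyIwaniec2002, §6 (6.33)] -/
theorem genusPhi_eq {σ : ℕ → ℝ} {κ ℓ ε₁ ε₂ : ℝ} {v w : ℕ}
    (hZ : ∀ s : ℂ, 1 < s.re → LSeries (fun h : ℕ => (σ h : ℂ)) s =
      κ * ℓ ^ 2 * (ε₁ * genusZFactor v w s + ε₂ * genusZFactor w v s) *
        riemannZeta s * riemannZeta (s + 1))
    {s : ℂ} (hs : 1 < s.re) :
    LSeries (fun n : ℕ => (σ n : ℂ)) s * mellin (fun x : ℝ => ((ciL K x : ℝ) : ℂ)) s =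
      genusPhi K κ ℓ ε₁ ε₂ v w s := by
  have hs1 : s ≠ 1 := by intro h; rw [h] at hs; simp at hs
  rw [genusPhi, dslope_mul_zeta₁_eq hK hs1, hZ s hs]
  push_cast
  ring

end Phi

/-! ### Bounds for `Φ` on vertical lines -/

section PhiBounds

/-- **Near `t = 0`**: an ABSOLUTE `C` with `‖(dslope M 1·ζ₁·ζ(·+1))(s)‖ ≤ C/|s|²` for every
admissible kernel and `0 < Re s ≤ 1/2`, `|Im s| ≤ 3` (`‖M(s)‖ ≤ 2/|s|`, `ζ₁` bounded on the two
rectangles, `|s−1| ≥ 1/2`, `ζ(s+1) = ζ₁(s+1)/s`). [cite: ConreyIwaniec2002, §6 (6.33)] -/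
theorem exists_bound_core_near :
    ∃ C : ℝ, 0 < C ∧ ∀ (K : ℝ → ℝ), IsCIKernel K → ∀ s : ℂ, 0 < s.re → s.re ≤ 1 / 2 → |s.im| ≤ 3 →
      ‖dslope (mellin fun x : ℝ => ((ciL K x : ℝ) : ℂ)) 1 s * riemannZeta₁ s * riemannZeta (s + 1)‖ ≤
        C / ‖s‖ ^ 2 := by
  obtain ⟨C₀, hC₀, h0⟩ := exists_bound_zeta₁_rect 0 1
  obtain ⟨C₁, hC₁, h1⟩ := exists_bound_zeta₁_rect 1 2
  refine ⟨4 * C₀ * C₁, by positivity, fun K hK s hs0 hs1 hs3 => ?_⟩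
  have hsne1 : s ≠ 1 := by intro h; rw [h] at hs1; norm_num at hs1
  have hsne0 : s ≠ 0 := by intro h; rw [h] at hs0; simp at hs0
  have hns : 0 < ‖s‖ := norm_pos_iff.mpr hsne0
  rw [dslope_mul_zeta₁_eq hK hsne1]
  have hM : ‖mellin (fun x : ℝ => ((ciL K x : ℝ) : ℂ)) s‖ ≤ 2 / ‖s‖ :=
    norm_mellin_ciL_le_one hK hs0 (by linarith)
  have hζ : ‖riemannZeta s‖ ≤ 2 * C₀ := by
    rw [riemannZeta_eq_inv_sub_mul hsne1, norm_mul, norm_inv]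
    have hd : (1 / 2 : ℝ) ≤ ‖s - 1‖ := by
      calc (1 / 2 : ℝ) ≤ |(s - 1).re| := by
            rw [Complex.sub_re, Complex.one_re, abs_of_nonpos (by linarith)]; linarith
        _ ≤ ‖s - 1‖ := Complex.abs_re_le_norm _
    have hinv : ‖s - 1‖⁻¹ ≤ 2 := by
      rw [inv_le_comm₀ (by linarith) (by norm_num)]; linarith
    exact mul_le_mul hinv (h0 s hs0.le (by linarith) hs3) (norm_nonneg _) (by norm_num)
  have hζ1 : ‖riemannZeta (s + 1)‖ ≤ C₁ / ‖s‖ := by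
    have hne : s + 1 ≠ 1 := by intro h; apply hsne0; linear_combination h
    rw [riemannZeta_eq_inv_sub_mul hne, norm_mul, norm_inv, add_sub_cancel_right]
    calc ‖s‖⁻¹ * ‖riemannZeta₁ (s + 1)‖ ≤ ‖s‖⁻¹ * C₁ := by
          gcongr
          exact h1 (s + 1) (by simp; linarith) (by simp; linarith) (by simpa using hs3)
      _ = C₁ / ‖s‖ := by rw [inv_mul_eq_div]
  calc ‖mellin (fun x : ℝ => ((ciL K x : ℝ) : ℂ)) s * riemannZeta s * riemannZeta (s + 1)‖
      = ‖mellin (fun x : ℝ => ((ciL K x : ℝ) : ℂ)) s‖ * ‖riemannZeta s‖ * ‖riemannZeta (s + 1)‖ := by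
        rw [norm_mul, norm_mul]
    _ ≤ (2 / ‖s‖) * (2 * C₀) * (C₁ / ‖s‖) := by
        gcongr
    _ = 4 * C₀ * C₁ / ‖s‖ ^ 2 := by field_simp; ring

variable {K : ℝ → ℝ} (hK : IsCIKernel K)
include hK

/-- **Far from `t = 0` on `Re s = c ∈ (0, 1/2]`**: for `|t| ≥ 3`,
`‖(dslope M 1·ζ₁·ζ(·+1))(c+it)‖ ≤ 630 log|t|/|t|^{3/2}`, and `≤ 2646 log²|t|/|t|^{5/2}` when
`c ≤ 1/(2 log|t|)` (three integrations by parts for `M`, the functional-equation bound for `ζ`,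
Titchmarsh 3.5 for `ζ(s+1)`). [cite: ConreyIwaniec2002, §6 (6.32)–(6.33)] -/
theorem norm_core_far_le {c t : ℝ} (hc : 0 < c) (hc2 : c ≤ 1 / 2) (ht : 3 ≤ |t|) :
    ‖dslope (mellin fun x : ℝ => ((ciL K x : ℝ) : ℂ)) 1 (c + t * I) * riemannZeta₁ (c + t * I) *
        riemannZeta (c + t * I + 1)‖ ≤ 630 * Real.log |t| / |t| ^ (3 / 2 : ℝ) ∧
      (c ≤ 1 / (2 * Real.log |t|) →
        ‖dslope (mellin fun x : ℝ => ((ciL K x : ℝ) : ℂ)) 1 (c + t * I) * riemannZeta₁ (c + t * I) *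
          riemannZeta (c + t * I + 1)‖ ≤ 2646 * Real.log |t| ^ 2 / |t| ^ (5 / 2 : ℝ)) := by
  set s : ℂ := c + t * I with hs
  have ht0 : 0 < |t| := by linarith
  have hsne1 : s ≠ 1 := by
    intro h; have := congrArg Complex.im h; simp [hs] at this; rw [this] at ht; norm_num at ht
  have hre : s.re = c := by simp [hs]
  have him : s.im = t := by simp [hs]
  -- `‖M(s)‖ ≤ 3/|t|³`
  have hnorm_ge : ∀ z : ℂ, z.im = t → |t| ≤ ‖z‖ := fun z hz => by
    rw [← hz]; exact Complex.abs_im_le_norm z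
  have hM : ‖mellin (fun x : ℝ => ((ciL K x : ℝ) : ℂ)) s‖ ≤ 3 / |t| ^ 3 := by
    have h := norm_mellin_ciL_le_three hK (s := s) (by rw [hre]; exact hc) (by rw [hre]; exact hc2)
    refine h.trans ?_
    have h1 : |t| ≤ ‖s‖ := hnorm_ge s him
    have h2 : |t| ≤ ‖s + 1‖ := hnorm_ge (s + 1) (by simp [him])
    have h3 : |t| ≤ ‖s + 2‖ := hnorm_ge (s + 2) (by simp [him])
    have : |t| ^ 3 ≤ ‖s‖ * ‖s + 1‖ * ‖s + 2‖ := by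
      calc |t| ^ 3 = |t| * |t| * |t| := by ring
        _ ≤ ‖s‖ * ‖s + 1‖ * ‖s + 2‖ := by gcongr
    exact div_le_div_of_nonneg_left (by norm_num) (by positivity) this
  have hζ1 : ‖riemannZeta (s + 1)‖ ≤ 21 * Real.log |t| := norm_zeta_right_le hc.le ht
  have hlog0 : 0 < Real.log |t| := Real.log_pos (by linarith)
  obtain ⟨hζa, hζb⟩ := norm_zeta_left_le (c := c) (t := t) hc hc2 ht
  rw [dslope_mul_zeta₁_eq hK hsne1, norm_mul, norm_mul]
  refine ⟨?_, fun hcl => ?_⟩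
  · calc ‖mellin (fun x : ℝ => ((ciL K x : ℝ) : ℂ)) s‖ * ‖riemannZeta s‖ * ‖riemannZeta (s + 1)‖
        ≤ (3 / |t| ^ 3) * (10 * |t| ^ (3 / 2 : ℝ)) * (21 * Real.log |t|) := by gcongr
      _ = 630 * Real.log |t| / |t| ^ (3 / 2 : ℝ) := by
          have e : |t| ^ 3 = |t| ^ (3 / 2 : ℝ) * |t| ^ (3 / 2 : ℝ) := by
            rw [← Real.rpow_add ht0]; norm_num
          rw [e]; field_simp; norm_num
  · calc ‖mellin (fun x : ℝ => ((ciL K x : ℝ) : ℂ)) s‖ * ‖riemannZeta s‖ * ‖riemannZeta (s + 1)‖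
        ≤ (3 / |t| ^ 3) * (42 * |t| ^ (1 / 2 : ℝ) * Real.log |t|) * (21 * Real.log |t|) := by
          gcongr; exact hζb hcl
      _ = 2646 * Real.log |t| ^ 2 / |t| ^ (5 / 2 : ℝ) := by
          have e : |t| ^ 3 = |t| ^ (1 / 2 : ℝ) * |t| ^ (5 / 2 : ℝ) := by
            rw [← Real.rpow_add ht0]; norm_num
          rw [e]; field_simp; norm_num

/-- **Uniformly in the strip `c₀ ≤ Re s ≤ 3/2`** (for moving the line): for `|t| ≥ 3`,
`‖(dslope M 1·ζ₁·ζ(·+1))(c+it)‖ ≤ 63(1 + c₀⁻¹)(|t|+2) log|t|/t²`.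
[cite: ConreyIwaniec2002, §6 (6.33)–(6.34)] -/
theorem norm_core_strip_le {c₀ c t : ℝ} (hc₀ : 0 < c₀) (hc : c₀ ≤ c) (hc2 : c ≤ 3 / 2)
    (ht : 3 ≤ |t|) :
    ‖dslope (mellin fun x : ℝ => ((ciL K x : ℝ) : ℂ)) 1 (c + t * I) * riemannZeta₁ (c + t * I) *
        riemannZeta (c + t * I + 1)‖ ≤ 63 * (1 + c₀⁻¹) * (|t| + 2) * Real.log |t| / t ^ 2 := by
  set s : ℂ := c + t * I with hs
  have ht0 : 0 < |t| := by linarith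
  have hcpos : 0 < c := by linarith
  have hsne1 : s ≠ 1 := by
    intro h; have := congrArg Complex.im h; simp [hs] at this; rw [this] at ht; norm_num at ht
  have hre : s.re = c := by simp [hs]
  have him : s.im = t := by simp [hs]
  have hnorm_ge : ∀ z : ℂ, z.im = t → |t| ≤ ‖z‖ := fun z hz => by
    rw [← hz]; exact Complex.abs_im_le_norm z
  have hM : ‖mellin (fun x : ℝ => ((ciL K x : ℝ) : ℂ)) s‖ ≤ 3 / t ^ 2 := by
    have h := norm_mellin_ciL_le_two hK (s := s) (by rw [hre]; exact hcpos) (by rw [hre]; exact hc2)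
    refine h.trans ?_
    have h1 : |t| ≤ ‖s‖ := hnorm_ge s him
    have h2 : |t| ≤ ‖s + 1‖ := hnorm_ge (s + 1) (by simp [him])
    have : t ^ 2 ≤ ‖s‖ * ‖s + 1‖ := by
      calc t ^ 2 = |t| * |t| := by rw [← sq_abs]; ring
        _ ≤ ‖s‖ * ‖s + 1‖ := by gcongr
    have ht2 : 0 < t ^ 2 := by rw [← sq_abs]; positivity
    exact div_le_div_of_nonneg_left (by norm_num) ht2 this
  have hζ : ‖riemannZeta s‖ ≤ (|t| + 2) * (1 + c₀⁻¹) := by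
    have h := norm_zeta_le_crude (σ := c) (t := t) hcpos (by linarith) ht
    refine h.trans ?_
    gcongr
  have hζ1 : ‖riemannZeta (s + 1)‖ ≤ 21 * Real.log |t| := norm_zeta_right_le hcpos.le ht
  have hlog0 : 0 < Real.log |t| := Real.log_pos (by linarith)
  rw [dslope_mul_zeta₁_eq hK hsne1, norm_mul, norm_mul]
  calc ‖mellin (fun x : ℝ => ((ciL K x : ℝ) : ℂ)) s‖ * ‖riemannZeta s‖ * ‖riemannZeta (s + 1)‖
      ≤ (3 / t ^ 2) * ((|t| + 2) * (1 + c₀⁻¹)) * (21 * Real.log |t|) := by gcongr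
    _ = 63 * (1 + c₀⁻¹) * (|t| + 2) * Real.log |t| / t ^ 2 := by
        field_simp; ring

/-- **On the line `Re s = 3/2`**: `‖(dslope M 1·ζ₁·ζ(·+1))(3/2+it)‖ ≤ 3ζ(3/2)ζ(5/2)/(9/4 + t²)`.
[cite: ConreyIwaniec2002, §6 (6.34)] -/
theorem norm_core_threeHalves_le (t : ℝ) :
    ‖dslope (mellin fun x : ℝ => ((ciL K x : ℝ) : ℂ)) 1 ((3 / 2 : ℝ) + t * I) *
        riemannZeta₁ ((3 / 2 : ℝ) + t * I) * riemannZeta ((3 / 2 : ℝ) + t * I + 1)‖ ≤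
      3 * (riemannZeta (3 / 2 : ℝ)).re * (riemannZeta (5 / 2 : ℝ)).re / (9 / 4 + t ^ 2) := by
  set s : ℂ := (3 / 2 : ℝ) + t * I with hs
  have hsne1 : s ≠ 1 := by
    intro h; have := congrArg Complex.re h; simp [hs] at this; norm_num at this
  have hre : s.re = 3 / 2 := by simp [hs]
  have hns : ‖s‖ ^ 2 = 9 / 4 + t ^ 2 := by
    rw [Complex.sq_norm, Complex.normSq_apply]; simp [hs]; ring
  have hM : ‖mellin (fun x : ℝ => ((ciL K x : ℝ) : ℂ)) s‖ ≤ 3 / (9 / 4 + t ^ 2) := by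
    have h := norm_mellin_ciL_le_two hK (s := s) (by rw [hre]; norm_num) (by rw [hre])
    refine h.trans ?_
    have h1 : ‖s‖ ≤ ‖s + 1‖ := by
      have : ‖s‖ ^ 2 ≤ ‖s + 1‖ ^ 2 := by
        rw [Complex.sq_norm, Complex.sq_norm, Complex.normSq_apply, Complex.normSq_apply]
        simp [hs]; nlinarith
      exact (sq_le_sq₀ (norm_nonneg _) (norm_nonneg _)).mp this
    have hpos : 0 < 9 / 4 + t ^ 2 := by positivity
    have : 9 / 4 + t ^ 2 ≤ ‖s‖ * ‖s + 1‖ := by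
      calc 9 / 4 + t ^ 2 = ‖s‖ * ‖s‖ := by rw [← sq, hns]
        _ ≤ ‖s‖ * ‖s + 1‖ := by gcongr
    exact div_le_div_of_nonneg_left (by norm_num) hpos this
  have hζ : ‖riemannZeta s‖ ≤ (riemannZeta (3 / 2 : ℝ)).re := by
    have := norm_zeta_line_le (c := 3 / 2) (by norm_num) t
    simpa [hs] using this
  have hζ1 : ‖riemannZeta (s + 1)‖ ≤ (riemannZeta (5 / 2 : ℝ)).re := by
    have := norm_zeta_line_le (c := 5 / 2) (by norm_num) t
    have e : s + 1 = ((5 / 2 : ℝ) : ℂ) + t * I := by simp [hs]; ring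
    rw [e]; exact this
  have hz0 : 0 ≤ (riemannZeta (3 / 2 : ℝ)).re := le_trans (norm_nonneg _) hζ
  rw [dslope_mul_zeta₁_eq hK hsne1, norm_mul, norm_mul]
  calc ‖mellin (fun x : ℝ => ((ciL K x : ℝ) : ℂ)) s‖ * ‖riemannZeta s‖ * ‖riemannZeta (s + 1)‖
      ≤ (3 / (9 / 4 + t ^ 2)) * (riemannZeta (3 / 2 : ℝ)).re * (riemannZeta (5 / 2 : ℝ)).re := by
        gcongr
    _ = 3 * (riemannZeta (3 / 2 : ℝ)).re * (riemannZeta (5 / 2 : ℝ)).re / (9 / 4 + t ^ 2) := by ring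

end PhiBounds

/-! ### Vertical integrability, decay in the strip, and the line move -/

section LineMove

variable {K : ℝ → ℝ} (hK : IsCIKernel K) {κ ℓ ε₁ ε₂ : ℝ} {v w q : ℕ}
  (hq : Squarefree q) (hvw : v * w = q) (hκ0 : 0 ≤ κ) (hκ1 : κ ≤ 1) (hε₁ : |ε₁| ≤ 1) (hε₂ : |ε₂| ≤ 1)
include hK hq hvw hκ0 hκ1 hε₁ hε₂

omit hK in
/-- The arithmetic prefactor: `‖κℓ²(ε₁F_{v,w} + ε₂F_{w,v})(s)‖ ≤ 2ℓ²(1 + log q)` for `Re s ≥ 0`.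
[cite: ConreyIwaniec2002, §4 (4.34)] -/
theorem norm_prefactor_le {s : ℂ} (hs : 0 ≤ s.re) :
    ‖(((κ * ℓ ^ 2 : ℝ) : ℂ) * ((ε₁ : ℂ) * genusZFactor v w s + (ε₂ : ℂ) * genusZFactor w v s))‖ ≤
      2 * ℓ ^ 2 * (1 + Real.log q) := by
  have hwv : w * v = q := by rw [mul_comm]; exact hvw
  have h1 := norm_genusZFactor_le hq hvw hs
  have h2 := norm_genusZFactor_le hq hwv hs
  have hlog : 0 ≤ 1 + Real.log q := by
    have : 0 ≤ Real.log q := Real.log_natCast_nonneg q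
    linarith
  rw [norm_mul, Complex.norm_real, Real.norm_eq_abs, abs_of_nonneg (by positivity)]
  calc κ * ℓ ^ 2 * ‖(ε₁ : ℂ) * genusZFactor v w s + (ε₂ : ℂ) * genusZFactor w v s‖
      ≤ 1 * ℓ ^ 2 * (‖(ε₁ : ℂ) * genusZFactor v w s‖ + ‖(ε₂ : ℂ) * genusZFactor w v s‖) := by
        gcongr; exact norm_add_le _ _
    _ ≤ 1 * ℓ ^ 2 * (1 * (1 + Real.log q) + 1 * (1 + Real.log q)) := by
        rw [norm_mul, norm_mul, Complex.norm_real, Complex.norm_real, Real.norm_eq_abs, Real.norm_eq_abs]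
        gcongr
    _ = 2 * ℓ ^ 2 * (1 + Real.log q) := by ring

omit hq hvw hκ0 hκ1 hε₁ hε₂ in
/-- Continuity of `t ↦ Φ(c + it)` for `0 < c < 4`. [cite: ConreyIwaniec2002, §6 (6.33)] -/
theorem continuous_genusPhi_vertical {c : ℝ} (hc0 : 0 < c) (hc4 : c < 4) :
    Continuous fun t : ℝ => genusPhi K κ ℓ ε₁ ε₂ v w (c + t * I) := by
  have hd := differentiableOn_genusPhi hK κ ℓ ε₁ ε₂ v w
  have hline : Continuous fun t : ℝ => (c : ℂ) + t * I := by fun_prop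
  refine (hd.continuousOn.comp_continuous hline fun t => ?_)
  simp; exact ⟨hc0, hc4⟩

/-- **Vertical integrability of `Φ` on `Re s = c ∈ (0, 1/2]`** (domination by `(1+|t|)^{-5/4}`).
[cite: ConreyIwaniec2002, §6 (6.34)] -/
theorem verticalIntegrable_genusPhi {c : ℝ} (hc0 : 0 < c) (hc2 : c ≤ 1 / 2) :
    Complex.VerticalIntegrable (genusPhi K κ ℓ ε₁ ε₂ v w) c := by
  obtain ⟨C, hC, hnear⟩ := exists_bound_core_near
  unfold Complex.VerticalIntegrable
  set A : ℝ := 2 * ℓ ^ 2 * (1 + Real.log q) * (8 * C / c ^ 2 + 10080) with hA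
  have hlogq : 0 ≤ 1 + Real.log q := by
    have : 0 ≤ Real.log q := Real.log_natCast_nonneg q; linarith
  have hdom : Integrable fun t : ℝ => A * (1 + ‖t‖) ^ (-(5 / 4 : ℝ)) :=
    (integrable_one_add_norm (by simp; norm_num)).const_mul A
  refine Integrable.mono' hdom (continuous_genusPhi_vertical hK hc0
    (by linarith)).aestronglyMeasurable (Eventually.of_forall fun t => ?_)
  set s : ℂ := c + t * I with hs
  have hre : s.re = c := by simp [hs]
  have him : s.im = t := by simp [hs]
  have hpre := norm_prefactor_le (ℓ := ℓ) hq hvw hκ0 hκ1 hε₁ hε₂ (s := s) (by rw [hre]; exact hc0.le)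
  have hsplit : ‖genusPhi K κ ℓ ε₁ ε₂ v w s‖ =
      ‖(((κ * ℓ ^ 2 : ℝ) : ℂ) * ((ε₁ : ℂ) * genusZFactor v w s + (ε₂ : ℂ) * genusZFactor w v s))‖ *
        ‖dslope (mellin fun x : ℝ => ((ciL K x : ℝ) : ℂ)) 1 s * riemannZeta₁ s * riemannZeta (s + 1)‖ := by
    rw [genusPhi, norm_mul, mul_assoc]
  have h1t : 0 < 1 + |t| := by positivity
  rw [Real.norm_eq_abs, hsplit]
  rcases le_or_gt |t| 3 with ht | ht
  · -- near part
    have hcore := hnear K hK s (by rw [hre]; exact hc0) (by rw [hre]; exact hc2) (by rw [him]; exact ht)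
    have hns : c ≤ ‖s‖ := by
      calc c = |s.re| := by rw [hre, abs_of_pos hc0]
        _ ≤ ‖s‖ := Complex.abs_re_le_norm s
    have hcore' : ‖dslope (mellin fun x : ℝ => ((ciL K x : ℝ) : ℂ)) 1 s * riemannZeta₁ s *
        riemannZeta (s + 1)‖ ≤ C / c ^ 2 := by
      refine hcore.trans (div_le_div_of_nonneg_left hC.le (by positivity) ?_)
      exact pow_le_pow_left₀ hc0.le hns 2
    -- `(1+|t|)^{-5/4} ≥ 1/8` for `|t| ≤ 3`
    have hw : (1 : ℝ) / 8 ≤ (1 + |t|) ^ (-(5 / 4 : ℝ)) := by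
      rw [Real.rpow_neg h1t.le, one_div]
      apply inv_anti₀ (by positivity)
      have h48 : (4 : ℝ) ^ (3 / 2 : ℝ) = 8 := by
        rw [show (4 : ℝ) = (2 : ℝ) ^ (2 : ℝ) by norm_num [Real.rpow_two], ← Real.rpow_mul (by norm_num)]
        rw [show (2 : ℝ) * (3 / 2) = ((3 : ℕ) : ℝ) by norm_num, Real.rpow_natCast]; norm_num
      calc (1 + |t|) ^ (5 / 4 : ℝ) ≤ (4 : ℝ) ^ (5 / 4 : ℝ) :=
            Real.rpow_le_rpow h1t.le (by linarith) (by norm_num)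
        _ ≤ (4 : ℝ) ^ (3 / 2 : ℝ) := Real.rpow_le_rpow_of_exponent_le (by norm_num) (by norm_num)
        _ = 8 := h48
    calc ‖(((κ * ℓ ^ 2 : ℝ) : ℂ) * ((ε₁ : ℂ) * genusZFactor v w s + (ε₂ : ℂ) * genusZFactor w v s))‖ *
          ‖dslope (mellin fun x : ℝ => ((ciL K x : ℝ) : ℂ)) 1 s * riemannZeta₁ s * riemannZeta (s + 1)‖
        ≤ (2 * ℓ ^ 2 * (1 + Real.log q)) * (C / c ^ 2) :=
          mul_le_mul hpre hcore' (norm_nonneg _) (by positivity)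
      _ = (2 * ℓ ^ 2 * (1 + Real.log q) * (8 * C / c ^ 2)) * (1 / 8) := by ring
      _ ≤ (2 * ℓ ^ 2 * (1 + Real.log q) * (8 * C / c ^ 2)) * (1 + |t|) ^ (-(5 / 4 : ℝ)) := by
          gcongr
      _ ≤ A * (1 + |t|) ^ (-(5 / 4 : ℝ)) := by
          gcongr
          rw [hA]; gcongr; linarith
  · -- far part
    have hcore := (norm_core_far_le hK (c := c) (t := t) hc0 hc2 ht.le).1
    have ht0 : 0 < |t| := by linarith
    have hlog : Real.log |t| ≤ 4 * |t| ^ (1 / 4 : ℝ) := by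
      have := Real.log_le_rpow_div ht0.le (by norm_num : (0:ℝ) < 1 / 4); linarith
    have hfar : 630 * Real.log |t| / |t| ^ (3 / 2 : ℝ) ≤ 10080 * (1 + |t|) ^ (-(5 / 4 : ℝ)) := by
      have e1 : |t| ^ (1 / 4 : ℝ) / |t| ^ (3 / 2 : ℝ) = |t| ^ (-(5 / 4 : ℝ)) := by
        rw [← Real.rpow_sub ht0]; norm_num
      have e2 : |t| ^ (-(5 / 4 : ℝ)) ≤ 4 * (1 + |t|) ^ (-(5 / 4 : ℝ)) := by
        rw [Real.rpow_neg ht0.le, Real.rpow_neg h1t.le]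
        have h2 : (1 + |t|) ^ (5 / 4 : ℝ) ≤ 4 * |t| ^ (5 / 4 : ℝ) := by
          calc (1 + |t|) ^ (5 / 4 : ℝ) ≤ (2 * |t|) ^ (5 / 4 : ℝ) :=
                Real.rpow_le_rpow h1t.le (by linarith) (by norm_num)
            _ = (2 : ℝ) ^ (5 / 4 : ℝ) * |t| ^ (5 / 4 : ℝ) := Real.mul_rpow (by norm_num) ht0.le
            _ ≤ 4 * |t| ^ (5 / 4 : ℝ) := by
                gcongr
                calc (2 : ℝ) ^ (5 / 4 : ℝ) ≤ (2 : ℝ) ^ (2 : ℝ) :=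
                      Real.rpow_le_rpow_of_exponent_le (by norm_num) (by norm_num)
                  _ = 4 := by norm_num [Real.rpow_two]
        have hp : 0 < |t| ^ (5 / 4 : ℝ) := Real.rpow_pos_of_pos ht0 _
        have hp1 : 0 < (1 + |t|) ^ (5 / 4 : ℝ) := Real.rpow_pos_of_pos h1t _
        rw [show (4 : ℝ) * ((1 + |t|) ^ (5 / 4 : ℝ))⁻¹ = ((1 + |t|) ^ (5 / 4 : ℝ) / 4)⁻¹ by
          rw [inv_div]; ring]
        apply inv_anti₀ (by positivity)
        linarith
      calc 630 * Real.log |t| / |t| ^ (3 / 2 : ℝ) ≤ 630 * (4 * |t| ^ (1 / 4 : ℝ)) / |t| ^ (3 / 2 : ℝ) := by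
            gcongr
        _ = 2520 * |t| ^ (-(5 / 4 : ℝ)) := by rw [← e1]; ring
        _ ≤ 2520 * (4 * (1 + |t|) ^ (-(5 / 4 : ℝ))) := by gcongr
        _ = 10080 * (1 + |t|) ^ (-(5 / 4 : ℝ)) := by ring
    calc ‖(((κ * ℓ ^ 2 : ℝ) : ℂ) * ((ε₁ : ℂ) * genusZFactor v w s + (ε₂ : ℂ) * genusZFactor w v s))‖ *
          ‖dslope (mellin fun x : ℝ => ((ciL K x : ℝ) : ℂ)) 1 s * riemannZeta₁ s * riemannZeta (s + 1)‖
        ≤ (2 * ℓ ^ 2 * (1 + Real.log q)) * (10080 * (1 + |t|) ^ (-(5 / 4 : ℝ))) :=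
          mul_le_mul hpre (hcore.trans hfar) (norm_nonneg _) (by positivity)
      _ = (2 * ℓ ^ 2 * (1 + Real.log q) * 10080) * (1 + |t|) ^ (-(5 / 4 : ℝ)) := by ring
      _ ≤ A * (1 + |t|) ^ (-(5 / 4 : ℝ)) := by
          gcongr
          rw [hA]
          have : 0 ≤ 8 * C / c ^ 2 := by positivity
          gcongr; linarith

end LineMove

section LineMove2

variable {K : ℝ → ℝ} (hK : IsCIKernel K) {κ ℓ ε₁ ε₂ : ℝ} {v w q : ℕ}
  (hq : Squarefree q) (hvw : v * w = q) (hκ0 : 0 ≤ κ) (hκ1 : κ ≤ 1) (hε₁ : |ε₁| ≤ 1) (hε₂ : |ε₂| ≤ 1)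
include hK hq hvw hκ0 hκ1 hε₁ hε₂

/-- **Vertical integrability of `Φ` on `Re s = 3/2`** (`≪ 1/(9/4 + t²)`).
[cite: ConreyIwaniec2002, §6 (6.34)] -/
theorem verticalIntegrable_genusPhi_threeHalves :
    Complex.VerticalIntegrable (genusPhi K κ ℓ ε₁ ε₂ v w) (3 / 2) := by
  unfold Complex.VerticalIntegrable
  set Z : ℝ := 3 * (riemannZeta (3 / 2 : ℝ)).re * (riemannZeta (5 / 2 : ℝ)).re with hZ
  set A : ℝ := 2 * ℓ ^ 2 * (1 + Real.log q) * Z with hA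
  have hdom : Integrable fun t : ℝ => A * (1 + t ^ 2)⁻¹ := integrable_inv_one_add_sq.const_mul A
  refine Integrable.mono' hdom (continuous_genusPhi_vertical hK (by norm_num)
    (by norm_num)).aestronglyMeasurable (Eventually.of_forall fun t => ?_)
  set s : ℂ := ((3 / 2 : ℝ) : ℂ) + t * I with hs
  have hre : s.re = 3 / 2 := by simp [hs]
  have hpre := norm_prefactor_le (ℓ := ℓ) hq hvw hκ0 hκ1 hε₁ hε₂ (s := s) (by rw [hre]; norm_num)
  have hcore := norm_core_threeHalves_le hK t
  have hZ0 : 0 ≤ Z := by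
    have h := hcore
    have : 0 ≤ 3 * (riemannZeta (3 / 2 : ℝ)).re * (riemannZeta (5 / 2 : ℝ)).re / (9 / 4 + t ^ 2) :=
      le_trans (norm_nonneg _) h
    have hpos : (0:ℝ) < 9 / 4 + t ^ 2 := by positivity
    rw [hZ]
    by_contra hneg
    push Not at hneg
    have : 3 * (riemannZeta (3 / 2 : ℝ)).re * (riemannZeta (5 / 2 : ℝ)).re / (9 / 4 + t ^ 2) < 0 :=
      div_neg_of_neg_of_pos hneg hpos
    linarith
  rw [genusPhi, norm_mul]
  calc ‖(((κ * ℓ ^ 2 : ℝ) : ℂ) * ((ε₁ : ℂ) * genusZFactor v w s + (ε₂ : ℂ) * genusZFactor w v s))‖ *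
        ‖dslope (mellin fun x : ℝ => ((ciL K x : ℝ) : ℂ)) 1 s * riemannZeta₁ s * riemannZeta (s + 1)‖
      ≤ (2 * ℓ ^ 2 * (1 + Real.log q)) * (Z / (9 / 4 + t ^ 2)) := by
        refine mul_le_mul hpre ?_ (norm_nonneg _) (by positivity)
        rw [hZ]; exact hcore
    _ ≤ (2 * ℓ ^ 2 * (1 + Real.log q)) * (Z / (1 + t ^ 2)) := by
        have hlogq : 0 ≤ 1 + Real.log q := by
          have : 0 ≤ Real.log q := Real.log_natCast_nonneg q; linarith
        gcongr
        · linarith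
    _ = A * (1 + t ^ 2)⁻¹ := by rw [hA]; ring

/-- **Uniform decay in the strip `c ≤ Re s ≤ 3/2`.** [cite: ConreyIwaniec2002, §6 (6.34)] -/
theorem genusPhi_decay {c : ℝ} (hc0 : 0 < c) (hc2 : c ≤ 1 / 2) :
    ∀ ε : ℝ, 0 < ε → ∃ T₀ : ℝ, ∀ T : ℝ, T₀ ≤ |T| →
      ∀ c' ∈ Icc c (3 / 2), ‖genusPhi K κ ℓ ε₁ ε₂ v w (c' + T * I)‖ ≤ ε := by
  intro ε hε
  -- the bound `B(T) = 2ℓ²(1+log q)·63(1+c⁻¹)(|T|+2)log|T|/T² ≤ B' |T|^{-3/4}` for `|T| ≥ 3`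
  set A : ℝ := 2 * ℓ ^ 2 * (1 + Real.log q) * (63 * (1 + c⁻¹)) * 8 with hA
  have hlogq : 0 ≤ 1 + Real.log q := by
    have : 0 ≤ Real.log q := Real.log_natCast_nonneg q; linarith
  have hA0 : 0 ≤ A := by rw [hA]; positivity
  -- choose `T₀` with `A · T₀^{-3/4} ≤ ε`
  have htend : Tendsto (fun x : ℝ => A * x ^ (-(3 / 4 : ℝ))) atTop (𝓝 0) := by
    have := (tendsto_rpow_neg_atTop (by norm_num : (0:ℝ) < 3 / 4)).const_mul A
    simpa using this
  obtain ⟨T₁, hT₁⟩ := (htend.eventually (gt_mem_nhds hε)).exists_forall_of_atTop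
  refine ⟨max 3 T₁, fun T hT c' hc' => ?_⟩
  have hT3 : 3 ≤ |T| := le_trans (le_max_left _ _) hT
  have hTT₁ : T₁ ≤ |T| := le_trans (le_max_right _ _) hT
  have hT0 : 0 < |T| := by linarith
  set s : ℂ := (c' : ℂ) + T * I with hs
  have hre : s.re = c' := by simp [hs]
  have hpre := norm_prefactor_le (ℓ := ℓ) hq hvw hκ0 hκ1 hε₁ hε₂ (s := s) (by rw [hre]; linarith [hc'.1])
  have hcore := norm_core_strip_le hK (c₀ := c) (c := c') (t := T) hc0 hc'.1 hc'.2 hT3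
  have hlogT : Real.log |T| ≤ 4 * |T| ^ (1 / 4 : ℝ) := by
    have := Real.log_le_rpow_div hT0.le (by norm_num : (0:ℝ) < 1 / 4); linarith
  have hT2 : T ^ 2 = |T| ^ (2 : ℝ) := by rw [Real.rpow_two, sq_abs]
  have hbd : 63 * (1 + c⁻¹) * (|T| + 2) * Real.log |T| / T ^ 2 ≤ 63 * (1 + c⁻¹) * 8 * |T| ^ (-(3 / 4 : ℝ)) := by
    rw [hT2]
    have h1 : |T| + 2 ≤ 2 * |T| := by linarith
    have hl0 : 0 ≤ Real.log |T| := Real.log_nonneg (by linarith)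
    have hc1 : 0 < 1 + c⁻¹ := by positivity
    calc 63 * (1 + c⁻¹) * (|T| + 2) * Real.log |T| / |T| ^ (2 : ℝ)
        ≤ 63 * (1 + c⁻¹) * (2 * |T|) * (4 * |T| ^ (1 / 4 : ℝ)) / |T| ^ (2 : ℝ) := by
          gcongr
      _ = 63 * (1 + c⁻¹) * 8 * (|T| ^ (1 : ℝ) * |T| ^ (1 / 4 : ℝ) / |T| ^ (2 : ℝ)) := by
          rw [Real.rpow_one]; ring
      _ = 63 * (1 + c⁻¹) * 8 * |T| ^ (-(3 / 4 : ℝ)) := by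
          rw [← Real.rpow_add hT0, ← Real.rpow_sub hT0]; norm_num
  rw [genusPhi, norm_mul]
  calc ‖(((κ * ℓ ^ 2 : ℝ) : ℂ) * ((ε₁ : ℂ) * genusZFactor v w s + (ε₂ : ℂ) * genusZFactor w v s))‖ *
        ‖dslope (mellin fun x : ℝ => ((ciL K x : ℝ) : ℂ)) 1 s * riemannZeta₁ s * riemannZeta (s + 1)‖
      ≤ (2 * ℓ ^ 2 * (1 + Real.log q)) * (63 * (1 + c⁻¹) * 8 * |T| ^ (-(3 / 4 : ℝ))) :=
        mul_le_mul hpre (hcore.trans hbd) (norm_nonneg _) (by positivity)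
    _ = A * |T| ^ (-(3 / 4 : ℝ)) := by rw [hA]; ring
    _ ≤ ε := (hT₁ |T| hTT₁).le

/-- **THE LINE MOVE: `D(u) = (1/2πi)∫_{(c)} Φ(s)u^{-s}ds` for every `0 < c ≤ 1/2`** (and `u > 0`):
`D = 𝓜⁻¹_{3/2}(Z·M) = 𝓜⁻¹_{3/2}Φ = 𝓜⁻¹_cΦ`. [cite: ConreyIwaniec2002, §6 (6.34)] -/
theorem ciD_eq_mellinInv_genusPhi {σ : ℕ → ℝ}
    (hσb : ∀ h : ℕ, 1 ≤ h → |σ h| ≤ 2 * ℓ ^ 2 * ∑ d ∈ Nat.divisors h, (d : ℝ)⁻¹)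
    (hZ : ∀ s : ℂ, 1 < s.re → LSeries (fun h : ℕ => (σ h : ℂ)) s =
      κ * ℓ ^ 2 * (ε₁ * genusZFactor v w s + ε₂ * genusZFactor w v s) *
        riemannZeta s * riemannZeta (s + 1))
    {c : ℝ} (hc0 : 0 < c) (hc2 : c ≤ 1 / 2) {u : ℝ} (hu : 0 < u) :
    ((ciD K σ u : ℝ) : ℂ) = mellinInv c (genusPhi K κ ℓ ε₁ ε₂ v w) u := by
  rw [ciD_eq_mellinInv hK hσb hu]
  -- on the line `3/2` the integrands agree
  have h32 : mellinInv (3 / 2) (fun s => LSeries (fun n : ℕ => (σ n : ℂ)) s *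
      mellin (fun v : ℝ => ((ciL K v : ℝ) : ℂ)) s) u = mellinInv (3 / 2) (genusPhi K κ ℓ ε₁ ε₂ v w) u := by
    unfold mellinInv
    congr 1
    refine integral_congr_ae (Eventually.of_forall fun y => ?_)
    simp only
    rw [genusPhi_eq hK hZ (s := (((3 / 2 : ℝ)) : ℂ) + y * I) (by simp; norm_num)]
  rw [h32]
  symm
  refine Literature.Analysis.Complex.mellinInv_eq_mellinInv_of_differentiableOn (by linarith) ?_
    (verticalIntegrable_genusPhi hK hq hvw hκ0 hκ1 hε₁ hε₂ hc0 hc2)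
    (verticalIntegrable_genusPhi_threeHalves hK hq hvw hκ0 hκ1 hε₁ hε₂)
    (genusPhi_decay hK hq hvw hκ0 hκ1 hε₁ hε₂ hc0 hc2) hu
  exact (differentiableOn_genusPhi hK κ ℓ ε₁ ε₂ v w).mono fun s hs => by
    simp only [Set.mem_preimage, Set.mem_Icc] at hs
    exact ⟨by linarith [hs.1], by linarith [hs.2]⟩

end LineMove2

end OffDiagMellin

end ConreyIwaniec2002

end Literature.NumberTheory.LFunctions

end
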